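import Mathlib.Tactic.NormNum
import Mathlib.Tactic.Linarith
import Mathlib.Tactic.Positivity
import Mathlib.Tactic.FieldSimp
import Mathlib.Tactic.Ring
import HarnessLib

/-!
# «Never pooled for the record»: what pooling two score tables can and cannot do to a §7 floor clause

Venture CertifiedManyBodySolver, cell `pub/hubbard-downfold`, seat hubbard-downfold-score-1 (second scoring engine);
namespace `Summit.Ventures.CertifiedManyBodySolver.Downfold.CellScore`. ACCEPTANCE §4 header («every number reported per
confidence class SEPARATELY — never pooled — and per material class»), v1.5 R35 («TWO TABLES: VALIDATION-SET v1 M01–M52c and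
tranche v2 M53–M71 are scored separately and never pooled for the record; the pooled file is a cross-check»), and the §7
rung-1 clauses, every one of which is a RATIO FLOOR `θ ≤ num/den` (R-score ≥ 0.90, accuracy(screening-grade) ≥ 0.80 pooled
and ≥ 0.70 per decided material, decided fraction ≥ 0.90 / 0.60 per class, inside-band credit ≥ 0.80, ordering ≥ 0.80).
Everything here is PROVED (linear arithmetic over ℚ; the mediant inequality).

WHAT THIS IS NOT: not a number about any run and not a scoring rule of its own — both engines (`deputy-2/score.py --table`,
`validation/score/phasemap.py --table v1|v2|all`) simply score the two tables separately as R35 says. This file is the KERNEL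
REFERENCE for WHY the rule is right and for exactly how far the pooled cross-check can be trusted:

* §1 `Tally` = (num, den) of one ratio in one table; `pool` = componentwise sum (= scoring the union of two disjoint
  tables, or of two confidence classes, or of the decided materials of a class); `ratio` (junk value 0 at den = 0, where
  both engines print the clause NA — see `applicable`); `meets θ t` = the floor test WITHOUT division, `θ·den ≤ num`
  (`meets_iff_le_ratio`: the same as `θ ≤ ratio` whenever the clause is applicable); `poolAll` pools a list.
* §2 THE TWO SAFE DIRECTIONS. `meets_pool`: two tables that each meet a floor meet it pooled; `meets_or_meets_of_meets_pool`:
  a pooled table that meets a floor has at least one part meeting it — equivalently (`meets_pool_eq_false`) two failing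
  tables never pool into a passing one. List forms `meets_poolAll_of_forall` / `exists_meets_of_meets_poolAll`. So the §7
  reading «≥ 0.70 per decided material ∧ ≥ 0.80 pooled» is not redundant in either direction, and the per-material clause at
  0.80 would IMPLY the pooled one (`meets_poolAll_of_forall`).
* §3 THE MEDIANT BOUNDS. `min_ratio_le_ratio_pool` / `ratio_pool_le_max_ratio` (both parts applicable): the pooled ratio
  lies between the two table ratios — it is a weighted average, never new information; list form
  `le_ratio_poolAll_of_forall_le` (the printed «per-material min» is ≤ the pooled accuracy).
* §4 THE UNSAFE DIRECTION = THE REASON FOR R35. `pool_hides_failing_table`: there are tables a (19/20) and b (8/10) and the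
  floor 9/10 of record such that a meets it, b FAILS it, and the pooled table 27/30 MEETS it — a pooled PASS can hide a
  failing tranche (or a failing confidence class), so a pooled number can never stand in for the per-table ones. And
  `pool_identity_of_den_zero`: a wholly not-applicable table (den = 0, e.g. an all-pending tranche) moves no pooled ratio.
* §5 numbers of record (run #5 = maps run-2026-08-26e, ACCEPTANCE v1.5, both engines): R-score v1 table 34/38 FAILS 0.90,
  v2 table 1/1 MEETS it, pooled 35/39 FAILS it (here pooling hid nothing; §4 shows it could have).
-/

namespace Summit.Ventures.CertifiedManyBodySolver.Downfold

namespace CellScore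

/-! ## §1 Tallies, pooling, the floor test -/

/-- One §4 ratio in one table: `num` successes out of `den` scored instances (e.g. R-score: AGREE out of
AGREE+PARTIAL+DISAGREE+ABSTAIN(uncoded); accuracy: agreeing decided cells out of decided cells). [folklore] -/
structure Tally where
  /-- numerator: successes -/
  num : ℕ
  /-- denominator: scored instances (0 = clause not applicable in this table) -/
  den : ℕ
  deriving DecidableEq, Repr

namespace Tally

/-- Pooling two tables = scoring their disjoint union: tallies add componentwise. [folklore] -/
def pool (a b : Tally) : Tally := ⟨a.num + b.num, a.den + b.den⟩

/-- The empty table. [folklore] -/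
def zero : Tally := ⟨0, 0⟩

/-- The printed ratio `num/den : ℚ`. JUNK VALUE: at `den = 0` Mathlib's division gives 0; both engines print the clause
`NA` there (see `applicable`), and no theorem below relies on the junk value. [folklore] -/
def ratio (t : Tally) : ℚ := (t.num : ℚ) / (t.den : ℚ)

/-- A clause is applicable in a table iff something was scored (`den > 0`); otherwise §7 prints NA. [folklore] -/
def applicable (t : Tally) : Bool := decide (0 < t.den)

/-- The floor test of a §7 clause WITHOUT division: `θ · den ≤ num`. (At `den = 0` this is vacuously true for every θ;
the engines print NA instead — `applicable` carries that distinction.) [folklore] -/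
def meets (θ : ℚ) (t : Tally) : Bool := decide (θ * (t.den : ℚ) ≤ (t.num : ℚ))

/-- Pool a whole list of tables (e.g. the decided materials of one class, or all confidence classes). [folklore] -/
def poolAll : List Tally → Tally
  | [] => zero
  | t :: ts => pool t (poolAll ts)

/-- `meets` unfolded to the inequality it decides. [folklore] -/
theorem meets_eq_true_iff (θ : ℚ) (t : Tally) : meets θ t = true ↔ θ * (t.den : ℚ) ≤ (t.num : ℚ) := by
  simp [meets]

/-- `meets` fails iff the floor is missed strictly. [folklore] -/
theorem meets_eq_false_iff (θ : ℚ) (t : Tally) : meets θ t = false ↔ (t.num : ℚ) < θ * (t.den : ℚ) := by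
  simp [meets]

/-- For an APPLICABLE clause the division-free test is exactly the printed comparison `θ ≤ num/den`. [folklore] -/
theorem meets_iff_le_ratio (θ : ℚ) (t : Tally) (h : 0 < t.den) : meets θ t = true ↔ θ ≤ t.ratio := by
  rw [meets_eq_true_iff, ratio, le_div_iff₀ (by exact_mod_cast h)]

/-- Pooling is commutative. [folklore] -/
theorem pool_comm (a b : Tally) : pool a b = pool b a := by
  simp [pool, Nat.add_comm]

/-- Pooling is associative (so a list may be pooled in any bracketing). [folklore] -/
theorem pool_assoc (a b c : Tally) : pool (pool a b) c = pool a (pool b c) := by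
  simp [pool, Nat.add_assoc]

/-- The empty table is a right identity. [folklore] -/
theorem pool_zero (a : Tally) : pool a zero = a := by
  simp [pool, zero]

/-- The empty table is a left identity. [folklore] -/
theorem zero_pool (a : Tally) : pool zero a = a := by
  simp [pool, zero]

/-- Numerator of a pooled table (cast to ℚ). [folklore] -/
theorem pool_num_cast (a b : Tally) : ((pool a b).num : ℚ) = a.num + b.num := by
  simp [pool]

/-- Denominator of a pooled table (cast to ℚ). [folklore] -/
theorem pool_den_cast (a b : Tally) : ((pool a b).den : ℚ) = a.den + b.den := by
  simp [pool]

/-! ## §2 The two safe directions -/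

/-- SAFE DIRECTION 1: two tables that each meet a floor meet it pooled (for ANY θ, applicable or not). In §7 terms: if every
confidence class / every tranche / every decided material meets a floor, the pooled number meets it too. [folklore] -/
theorem meets_pool (θ : ℚ) (a b : Tally) (ha : meets θ a = true) (hb : meets θ b = true) :
    meets θ (pool a b) = true := by
  rw [meets_eq_true_iff] at ha hb ⊢
  rw [pool_num_cast, pool_den_cast, mul_add]
  exact add_le_add ha hb

/-- SAFE DIRECTION 2: a pooled table that meets a floor has at least one part meeting it. [folklore] -/
theorem meets_or_meets_of_meets_pool (θ : ℚ) (a b : Tally) (h : meets θ (pool a b) = true) :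
    meets θ a = true ∨ meets θ b = true := by
  by_cases ha : meets θ a = true
  · exact Or.inl ha
  by_cases hb : meets θ b = true
  · exact Or.inr hb
  rw [Bool.not_eq_true, meets_eq_false_iff] at ha hb
  rw [meets_eq_true_iff, pool_num_cast, pool_den_cast, mul_add] at h
  exfalso
  linarith

/-- Contrapositive form used in reviews: two FAILING tables never pool into a passing one — pooling cannot manufacture a
PASS. [folklore] -/
theorem meets_pool_eq_false (θ : ℚ) (a b : Tally) (ha : meets θ a = false) (hb : meets θ b = false) :
    meets θ (pool a b) = false := by
  rw [meets_eq_false_iff] at ha hb ⊢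
  rw [pool_num_cast, pool_den_cast, mul_add]
  exact add_lt_add ha hb

/-- List form of direction 1: if every table in a list meets the floor, the pooled table meets it (the empty list pools to
the empty table, where every floor holds vacuously and the engines print NA). This is why «accuracy ≥ θ per decided
material» at the SAME θ would make the pooled clause redundant — §7 uses 0.70 per material and 0.80 pooled precisely so that
neither implies the other. [folklore] -/
theorem meets_poolAll_of_forall (θ : ℚ) (l : List Tally) (h : ∀ t ∈ l, meets θ t = true) :
    meets θ (poolAll l) = true := by
  induction l with
  | nil => simp [poolAll, zero, meets]
  | cons t ts ih =>
    simp only [poolAll]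
    exact meets_pool θ t (poolAll ts) (h t (by simp)) (ih fun u hu => h u (by simp [hu]))

/-- List form of direction 2: a NONEMPTY pooled list that meets a floor has a member meeting it. [folklore] -/
theorem exists_meets_of_meets_poolAll (θ : ℚ) (l : List Tally) (hl : l ≠ [])
    (h : meets θ (poolAll l) = true) : ∃ t ∈ l, meets θ t = true := by
  induction l with
  | nil => exact absurd rfl hl
  | cons t ts ih =>
    simp only [poolAll] at h
    rcases meets_or_meets_of_meets_pool θ t (poolAll ts) h with ht | hts
    · exact ⟨t, by simp, ht⟩
    · by_cases hts0 : ts = []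
      · subst hts0
        -- the tail is the empty table: then `pool t zero = t` carries the hypothesis itself
        refine ⟨t, by simp, ?_⟩
        simpa [poolAll, pool_zero] using h
      · obtain ⟨u, hu, hmu⟩ := ih hts0 hts
        exact ⟨u, by simp [hu], hmu⟩

/-! ## §3 The mediant bounds: a pooled ratio is a weighted average of its parts -/

/-- Lower mediant bound: with both parts applicable, the pooled ratio is at least the smaller table ratio. [folklore] -/
theorem min_ratio_le_ratio_pool (a b : Tally) (ha : 0 < a.den) (hb : 0 < b.den) :
    min a.ratio b.ratio ≤ (pool a b).ratio := by
  have ha' : (0 : ℚ) < a.den := by exact_mod_cast ha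
  have hb' : (0 : ℚ) < b.den := by exact_mod_cast hb
  have h1 : min a.ratio b.ratio * (a.den : ℚ) ≤ a.num := (le_div_iff₀ ha').mp (min_le_left _ _)
  have h2 : min a.ratio b.ratio * (b.den : ℚ) ≤ b.num := (le_div_iff₀ hb').mp (min_le_right _ _)
  show min a.ratio b.ratio ≤ ((pool a b).num : ℚ) / ((pool a b).den : ℚ)
  rw [pool_num_cast, pool_den_cast, le_div_iff₀ (by linarith), mul_add]
  exact add_le_add h1 h2

/-- Upper mediant bound: with both parts applicable, the pooled ratio is at most the larger table ratio. [folklore] -/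
theorem ratio_pool_le_max_ratio (a b : Tally) (ha : 0 < a.den) (hb : 0 < b.den) :
    (pool a b).ratio ≤ max a.ratio b.ratio := by
  have ha' : (0 : ℚ) < a.den := by exact_mod_cast ha
  have hb' : (0 : ℚ) < b.den := by exact_mod_cast hb
  have h1 : (a.num : ℚ) ≤ max a.ratio b.ratio * (a.den : ℚ) := (div_le_iff₀ ha').mp (le_max_left _ _)
  have h2 : (b.num : ℚ) ≤ max a.ratio b.ratio * (b.den : ℚ) := (div_le_iff₀ hb').mp (le_max_right _ _)
  show ((pool a b).num : ℚ) / ((pool a b).den : ℚ) ≤ max a.ratio b.ratio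
  rw [pool_num_cast, pool_den_cast, div_le_iff₀ (by linarith), mul_add]
  exact add_le_add h1 h2

/-- The pooled table of a list of applicable tables is applicable as soon as the list is nonempty. [folklore] -/
theorem poolAll_den_pos (l : List Tally) (hl : l ≠ []) (h : ∀ t ∈ l, 0 < t.den) : 0 < (poolAll l).den := by
  induction l with
  | nil => exact absurd rfl hl
  | cons t ts ih =>
    simp only [poolAll, pool]
    have := h t (by simp)
    omega

/-- List form of the lower bound (the printed «per-material min m» vs the pooled accuracy): if every table in a nonempty
list is applicable and has ratio ≥ m, the pooled ratio is ≥ m. [folklore] -/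
theorem le_ratio_poolAll_of_forall_le (m : ℚ) (l : List Tally) (hl : l ≠ []) (hden : ∀ t ∈ l, 0 < t.den)
    (h : ∀ t ∈ l, m ≤ t.ratio) : m ≤ (poolAll l).ratio := by
  -- go through the division-free test, which pools without any applicability bookkeeping
  have key : meets m (poolAll l) = true :=
    meets_poolAll_of_forall m l fun t ht => (meets_iff_le_ratio m t (hden t ht)).mpr (h t ht)
  exact (meets_iff_le_ratio m (poolAll l) (poolAll_den_pos l hl hden)).mp key

/-- List form of the upper bound: if every table in a nonempty list is applicable and has ratio ≤ M, so has the pooled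
table. [folklore] -/
theorem ratio_poolAll_le_of_forall_le (M : ℚ) (l : List Tally) (hl : l ≠ []) (hden : ∀ t ∈ l, 0 < t.den)
    (h : ∀ t ∈ l, t.ratio ≤ M) : (poolAll l).ratio ≤ M := by
  induction l with
  | nil => exact absurd rfl hl
  | cons t ts ih =>
    by_cases hts : ts = []
    · subst hts
      simpa [poolAll, pool_zero] using h t (by simp)
    · have hd : 0 < (poolAll ts).den := poolAll_den_pos ts hts fun u hu => hden u (by simp [hu])
      have hub : (poolAll ts).ratio ≤ M := ih hts (fun u hu => hden u (by simp [hu])) fun u hu => h u (by simp [hu])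
      simp only [poolAll]
      calc (pool t (poolAll ts)).ratio ≤ max t.ratio (poolAll ts).ratio :=
            ratio_pool_le_max_ratio t (poolAll ts) (hden t (by simp)) hd
        _ ≤ M := max_le (h t (by simp)) hub

/-! ## §4 The unsafe direction — why R35 says «never pooled for the record» -/

/-- THE HIDING WITNESS at the R-score floor of record 9/10: table a = 19/20 meets it, table b = 8/10 FAILS it, the pooled
table 27/30 MEETS it. A pooled PASS is compatible with a failing tranche / class / material — so the pooled cross-check
can confirm a failure (§2) but can never certify the parts. [folklore] -/
theorem pool_hides_failing_table :
    meets (9 / 10) ⟨19, 20⟩ = true ∧ meets (9 / 10) ⟨8, 10⟩ = false ∧ meets (9 / 10) (pool ⟨19, 20⟩ ⟨8, 10⟩) = true := by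
  refine ⟨?_, ?_, ?_⟩
  · rw [meets_eq_true_iff]; norm_num
  · rw [meets_eq_false_iff]; norm_num
  · rw [meets_eq_true_iff]; norm_num [pool]

/-- The same witness read as ratios: 8/10 < 9/10 ≤ 27/30 ≤ 19/20 — the pooled value sits inside the mediant interval of
§3 and on the passing side of the floor. [folklore] -/
theorem pool_hides_failing_table_ratios :
    Tally.ratio ⟨8, 10⟩ < 9 / 10 ∧ (9 : ℚ) / 10 ≤ (pool ⟨19, 20⟩ ⟨8, 10⟩).ratio ∧
      (pool ⟨19, 20⟩ ⟨8, 10⟩).ratio ≤ Tally.ratio ⟨19, 20⟩ := by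
  refine ⟨?_, ?_, ?_⟩ <;> norm_num [ratio, pool]

/-- Existential packaging of the witness (the statement reviewers quote). [folklore] -/
theorem exists_pool_meets_with_failing_part :
    ∃ (θ : ℚ) (a b : Tally), meets θ a = true ∧ meets θ b = false ∧ meets θ (pool a b) = true :=
  ⟨9 / 10, ⟨19, 20⟩, ⟨8, 10⟩, pool_hides_failing_table⟩

/-- A wholly NOT-APPLICABLE table (den = 0 and hence num = 0 for a ratio of counts — stated here with num = 0 explicitly,
e.g. an all-`pending` tranche) is the pooling identity: it moves no pooled number. [folklore] -/
theorem pool_identity_of_den_zero (a b : Tally) (hn : b.num = 0) (hd : b.den = 0) : pool a b = a := by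
  cases b
  simp only at hn hd
  subst hn; subst hd
  exact pool_zero a

/-- … and in particular cannot change whether any floor is met. [folklore] -/
theorem meets_pool_of_den_zero (θ : ℚ) (a b : Tally) (hn : b.num = 0) (hd : b.den = 0) :
    meets θ (pool a b) = meets θ a := by
  rw [pool_identity_of_den_zero a b hn hd]

/-! ## §5 Numbers of record: run #5 (maps run-2026-08-26e), R-score floor 0.90, both engines -/

/-- VALIDATION-SET v1 table of run #5: R-score 34 AGREE / 38 = 0.895 FAILS the 0.90 floor. [folklore] -/
theorem run5_v1_rscore_fails : meets (9 / 10) ⟨34, 38⟩ = false := by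
  rw [meets_eq_false_iff]; norm_num

/-- Tranche v2 table of run #5: R-score 1 AGREE / 1 MEETS the floor (18 of 19 materials pending, out of the
denominator). [folklore] -/
theorem run5_v2_rscore_meets : meets (9 / 10) ⟨1, 1⟩ = true := by
  rw [meets_eq_true_iff]; norm_num

/-- The pooled cross-check 35/39 = 0.897 FAILS the floor — consistent with §2 (`meets_or_meets_of_meets_pool` would have
allowed a pooled pass here since v2 passes; it did not happen because v2's weight is 1/39). [folklore] -/
theorem run5_pooled_rscore_fails : meets (9 / 10) (pool ⟨34, 38⟩ ⟨1, 1⟩) = false := by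
  rw [meets_eq_false_iff]; norm_num [pool]

/-- The pooled value lies inside the mediant interval [34/38, 1/1] as §3 says. [folklore] -/
theorem run5_pooled_rscore_between :
    Tally.ratio ⟨34, 38⟩ ≤ (pool ⟨34, 38⟩ ⟨1, 1⟩).ratio ∧ (pool ⟨34, 38⟩ ⟨1, 1⟩).ratio ≤ Tally.ratio ⟨1, 1⟩ := by
  constructor <;> norm_num [ratio, pool]

/-! ## §6 (appended g4) The floor test in integers: `meets (p/q) ⟨k, n⟩ ↔ p·n ≤ q·k` — the arithmetic behind DISTANCE-TO-PASS -/

/-- INTEGER FORM OF EVERY §7 FLOOR: for a positive denominator `q`, the tally `k / n` meets the floor `p / q` iff `p·n ≤ q·k` (no division,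
no rounding — this is the test `tools/distance_to_pass.py` counts against). [folklore] -/
theorem meets_div_iff (p q : ℕ) (hq : 0 < q) (k n : ℕ) :
    meets ((p : ℚ) / q) ⟨k, n⟩ = true ↔ p * n ≤ q * k := by
  rw [meets_eq_true_iff]
  have hq' : (0 : ℚ) < q := by exact_mod_cast hq
  constructor
  · intro h
    have h' : (p : ℚ) / q * n * q ≤ k * q := mul_le_mul_of_nonneg_right h hq'.le
    have : (p : ℚ) / q * n * q = p * n := by field_simp
    rw [this] at h'
    exact_mod_cast (by linarith : (p : ℚ) * n ≤ q * k)
  · intro h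
    have h' : (p : ℚ) * n ≤ q * k := by exact_mod_cast h
    have : (p : ℚ) / q * n = p * n / q := by ring
    rw [this, div_le_iff₀ hq']
    linarith

/-- R-score floor 0.90: `k` AGREE of `n` meets it iff `9·n ≤ 10·k`. [folklore] -/
theorem meets_nine_tenths_iff (k n : ℕ) : meets (9 / 10) ⟨k, n⟩ = true ↔ 9 * n ≤ 10 * k := by
  have := meets_div_iff 9 10 (by norm_num) k n
  push_cast at this
  exact this

/-- Cuprate / nickelate decided-fraction floor 0.60: iff `3·n ≤ 5·k`. [folklore] -/
theorem meets_three_fifths_iff (k n : ℕ) : meets (3 / 5) ⟨k, n⟩ = true ↔ 3 * n ≤ 5 * k := by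
  have := meets_div_iff 3 5 (by norm_num) k n
  push_cast at this
  exact this

/-- DISTANCE-TO-PASS numbers of RUN #6 (maps run-2026-08-27a, v1 table) by kernel: R-score 36/43 fails and needs 39/43 at today's
denominator (38/43 still fails); wording all 16 pending materials AGREE gives 52/59, which STILL fails — 54/59 is the first passing
tally at denominator 59 (53/59 fails) ⇒ at least two PARTIAL → AGREE conversions in every scenario. [folklore] -/
theorem run6_rscore_distance :
    meets (9 / 10) ⟨36, 43⟩ = false ∧ meets (9 / 10) ⟨38, 43⟩ = false ∧ meets (9 / 10) ⟨39, 43⟩ = true ∧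
      meets (9 / 10) ⟨52, 59⟩ = false ∧ meets (9 / 10) ⟨53, 59⟩ = false ∧ meets (9 / 10) ⟨54, 59⟩ = true := by
  refine ⟨?_, ?_, ?_, ?_, ?_, ?_⟩ <;>
    first
    | exact (meets_nine_tenths_iff _ _).mpr (by norm_num)
    | exact (Bool.eq_false_iff).mpr (fun h => absurd ((meets_nine_tenths_iff _ _).mp h) (by norm_num))

/-- Class floors of RUN #6 in counts: conventional needs 7/7 (6/7 fails 0.90), cuprate 12/19 is the first tally meeting 0.60 (11/19 fails),
nickelate 5/7 (4/7 fails), control-nonSC 4/4 (3/4 fails). [folklore] -/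
theorem run6_class_floor_distance :
    meets (9 / 10) ⟨6, 7⟩ = false ∧ meets (9 / 10) ⟨7, 7⟩ = true ∧ meets (3 / 5) ⟨11, 19⟩ = false ∧ meets (3 / 5) ⟨12, 19⟩ = true ∧
      meets (3 / 5) ⟨4, 7⟩ = false ∧ meets (3 / 5) ⟨5, 7⟩ = true ∧ meets (9 / 10) ⟨3, 4⟩ = false ∧ meets (9 / 10) ⟨4, 4⟩ = true := by
  refine ⟨?_, ?_, ?_, ?_, ?_, ?_, ?_, ?_⟩ <;>
    first
    | exact (meets_nine_tenths_iff _ _).mpr (by norm_num)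
    | exact (meets_three_fifths_iff _ _).mpr (by norm_num)
    | exact (Bool.eq_false_iff).mpr (fun h => absurd ((meets_nine_tenths_iff _ _).mp h) (by norm_num))
    | exact (Bool.eq_false_iff).mpr (fun h => absurd ((meets_three_fifths_iff _ _).mp h) (by norm_num))

end Tally

end CellScore

end Summit.Ventures.CertifiedManyBodySolver.Downfold
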